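import Mathlib.Geometry.Manifold.PartitionOfUnity
import Mathlib.Analysis.Calculus.BumpFunction.FiniteDimension
import Literature.Analysis.Distribution.NormalJetCalculus
import Literature.Analysis.Distribution.TranslationQuasiInvariantFunctionalOn
import HarnessLib

/-!
# Finite-order functionals carried by a linear subspace see only finitely many normal jets
# (Hörmander, Thm. 2.3.3)

Topic `Analysis/Distribution`; namespace `Literature.Analysis.Distribution`. Let `D` be a functional on
the test functions of a finite-dimensional real vector space which is **additive** on the test functions
supported in an open set `W` and satisfies there the finite-order estimate of a distribution
(`IsFiniteOrderOn`, Hörmander Def. 2.1.1). Two facts of the elementary theory of distributions: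

* §1 **localisation** (`apply_eq_zero_of_forall_exists_nhds`): if every point of `spt f` has a
  neighbourhood `U` with `D g = 0` for all test `g` supported in `U`, then `D f = 0` — a smooth partition of
  unity subordinate to a finite subcover (Hörmander, Thm. 2.2.1);
* §3 **Theorem 2.3.3** in the flat form we need (`apply_eq_zero_of_normalJetsVanishBelow`,
  `exists_nhds_normalOrderBelow`): on `B × Z`, if `D` vanishes on the test functions supported in `κ`
  off the subspace `{0} × Z` and satisfies on `κ` an estimate by word derivatives of length `≤ k`, then
  `D h = 0` for every test `h` supported in `κ` all of whose normal jets of order `≤ k` vanish on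
  `{0} × Z` (`NormalJetsVanishBelow (k+1) h`, `NormalJetCalculus`). Proof (Hörmander's): with a cutoff
  `χ_ε(b) = χ(b/ε)`, `D h = D(χ_ε h)` and every seminorm `sup |∂_w(χ_ε h)|`, `|w| ≤ k`, is `O(ε)` by the
  Leibniz rule — `∂_u χ_ε = O(ε^{-|u|})` on `‖b‖ ≤ 2ε` (§2) while `|∂_v h| ≤ A ‖b‖^{k+1-|v|}` by Taylor
  flatness.

`NormalOrderBelow D V j` (§3) names the conclusion: on the test functions supported in `V`, `D` depends
only on the normal jets of order `< j`. Everything is proved; no named fact is introduced.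

## References

* L. Hörmander, *The Analysis of Linear Partial Differential Operators I* (1983), Thm. 2.2.1, Thm. 2.3.3
  [HormanderALPDO1].
-/

noncomputable section

open Set Filter Topology Function Metric
open scoped ContDiff Manifold

namespace Literature.Analysis.Distribution

/-! ### 1. Localisation by smooth partitions of unity -/

section Localisation

variable {X : Type*} [NormedAddCommGroup X] [NormedSpace ℝ X] [FiniteDimensional ℝ X]

omit [FiniteDimensional ℝ X] in
/-- An additive functional annihilates `0`. [folklore] -/
theorem apply_zero_of_additive {D : (X → ℂ) → ℂ} {W : Set X}
    (hadd : ∀ f g : X → ℂ, IsTestFn f → IsTestFn g → tsupport f ⊆ W → tsupport g ⊆ W → D (f + g) = D f + D g) :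
    D 0 = 0 := by
  have h := hadd 0 0 IsTestFn.zero IsTestFn.zero (by simp [tsupport]) (by simp [tsupport])
  rw [add_zero] at h
  exact add_eq_left.1 h.symm

omit [FiniteDimensional ℝ X] in
/-- **Additivity over finite sums** of test functions supported in `W` (and the sum is again such).
[folklore] -/
theorem apply_finset_sum_of_additive {D : (X → ℂ) → ℂ} {W : Set X}
    (hadd : ∀ f g : X → ℂ, IsTestFn f → IsTestFn g → tsupport f ⊆ W → tsupport g ⊆ W → D (f + g) = D f + D g)
    {ι : Type*} (ψ : ι → X → ℂ) (s : Finset ι) (hψ : ∀ i ∈ s, IsTestFn (ψ i) ∧ tsupport (ψ i) ⊆ W) :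
    IsTestFn (∑ i ∈ s, ψ i) ∧ tsupport (∑ i ∈ s, ψ i) ⊆ W ∧ D (∑ i ∈ s, ψ i) = ∑ i ∈ s, D (ψ i) := by
  classical
  induction s using Finset.induction_on with
  | empty =>
    refine ⟨by simpa using IsTestFn.zero (X := X), by simp [tsupport], ?_⟩
    simpa using apply_zero_of_additive hadd
  | insert a s ha ih =>
    obtain ⟨hT, hS, hD⟩ := ih fun i hi => hψ i (Finset.mem_insert_of_mem hi)
    obtain ⟨ha1, ha2⟩ := hψ a (Finset.mem_insert_self a s)
    rw [Finset.sum_insert ha, Finset.sum_insert ha]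
    refine ⟨ha1.add hT, (tsupport_add _ _).trans (union_subset ha2 hS), ?_⟩
    rw [hadd _ _ ha1 hT ha2 hS, hD]

/-- **Localisation** (Hörmander, Thm. 2.2.1, for additive functionals): if every point of `spt f` has a
neighbourhood `U` such that `D g = 0` for all test functions `g` supported in `U`, then `D f = 0` — a smooth
partition of unity subordinate to a finite subcover of `spt f` writes `f = Σᵢ ρᵢ f`.
[cite: HormanderALPDO1, Thm. 2.2.1] -/
theorem apply_eq_zero_of_forall_exists_nhds {D : (X → ℂ) → ℂ} {W : Set X}
    (hadd : ∀ f g : X → ℂ, IsTestFn f → IsTestFn g → tsupport f ⊆ W → tsupport g ⊆ W → D (f + g) = D f + D g)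
    {f : X → ℂ} (hf : IsTestFn f) (hfW : tsupport f ⊆ W)
    (h : ∀ x ∈ tsupport f, ∃ U ∈ 𝓝 x, ∀ g : X → ℂ, IsTestFn g → tsupport g ⊆ U → D g = 0) : D f = 0 := by
  choose! U hU hDU using h
  have hK : IsCompact (tsupport f) := hf.hasCompactSupport
  obtain ⟨t, ht⟩ := hK.elim_finite_subcover (fun x : tsupport f => interior (U (x : X)))
    (fun _ => isOpen_interior) fun y hy => mem_iUnion.2 ⟨⟨y, hy⟩, mem_interior_iff_mem_nhds.2 (hU y hy)⟩
  obtain ⟨ρ, hρ⟩ := SmoothPartitionOfUnity.exists_isSubordinate 𝓘(ℝ, X) (isClosed_tsupport f)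
    (fun x : (t : Set (tsupport f)) => interior (U ((x : tsupport f) : X)))
    (fun _ => isOpen_interior) (fun y hy => by simpa using ht hy)
  -- the pieces `ρᵢ f`
  set ψ : ↥(↑t : Set ↥(tsupport f)) → X → ℂ := fun i x => ((ρ i x : ℝ) : ℂ) * f x with hψdef
  have hψT : ∀ i, IsTestFn (ψ i) := fun i =>
    hf.mul_left (Complex.ofRealCLM.contDiff.comp (contMDiff_iff_contDiff.1 (ρ i).contMDiff))
  have hψsupp : ∀ i, tsupport (ψ i) ⊆ tsupport f := fun i =>
    tsupport_mul_subset_right (f := fun x => ((ρ i x : ℝ) : ℂ)) (g := f)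
  have hψU : ∀ i, tsupport (ψ i) ⊆ U ((i : tsupport f) : X) := fun i => by
    refine ((tsupport_mul_subset_left (f := fun x => ((ρ i x : ℝ) : ℂ)) (g := f)).trans ?_).trans
      ((hρ i).trans interior_subset)
    -- `tsupport (ofReal ∘ ρ i) ⊆ tsupport (ρ i)`
    refine closure_mono fun x hx => ?_
    simpa [Function.mem_support] using hx
  have hDψ : ∀ i, D (ψ i) = 0 := fun i => hDU _ (i : tsupport f).2 _ (hψT i) (hψU i)
  have hsum : f = ∑ i, ψ i := by
    funext x
    rw [Finset.sum_apply]
    change f x = ∑ i, ((ρ i x : ℝ) : ℂ) * f x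
    rw [← Finset.sum_mul]
    by_cases hx : x ∈ tsupport f
    · have h1 : ∑ i, ((ρ i x : ℝ) : ℂ) = 1 := by
        rw [← Complex.ofReal_one, ← ρ.sum_eq_one hx, finsum_eq_sum_of_fintype, Complex.ofReal_sum]
      rw [h1, one_mul]
    · rw [image_eq_zero_of_notMem_tsupport hx, mul_zero]
  obtain ⟨-, -, hD⟩ := apply_finset_sum_of_additive hadd ψ Finset.univ fun i _ => ⟨hψT i, (hψsupp i).trans hfW⟩
  rw [hsum, hD]
  exact Finset.sum_eq_zero fun i _ => hDψ i

end Localisation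

/-! ### 2. The cutoff `χ_ε(b) = χ(b/ε)` transversal to `{0} × Z` -/

section Cutoff

variable {B : Type*} [NormedAddCommGroup B] [NormedSpace ℝ B] [FiniteDimensional ℝ B] {Z : Type*}

/-- A fixed bump function on `B`: `1` on the closed unit ball, supported in the ball of radius `2`. [folklore] -/
def normalBump : ContDiffBump (0 : B) := ⟨1, 2, one_pos, one_lt_two⟩

/-- The bump as a complex-valued function. [folklore] -/
def normalBumpC (b : B) : ℂ := ((normalBump (B := B) b : ℝ) : ℂ)

/-- `normalBumpC` is a test function. [folklore] -/
theorem isTestFn_normalBumpC : IsTestFn (normalBumpC (B := B)) :=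
  ⟨Complex.ofRealCLM.contDiff.comp (normalBump (B := B)).contDiff,
    (normalBump (B := B)).hasCompactSupport.comp_left Complex.ofReal_zero⟩

/-- `normalBumpC = 1` on the closed unit ball. [folklore] -/
theorem normalBumpC_eq_one {b : B} (hb : ‖b‖ ≤ 1) : normalBumpC b = 1 := by
  have h : normalBump (B := B) b = 1 := (normalBump (B := B)).one_of_mem_closedBall (by simpa [normalBump] using hb)
  simp [normalBumpC, h]

/-- `normalBumpC` and all its word derivatives vanish off the closed ball of radius `2`. [folklore] -/
theorem vecWordDeriv_normalBumpC_eq_zero (w : List B) {b : B} (hb : 2 < ‖b‖) : vecWordDeriv w normalBumpC b = 0 := by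
  refine image_eq_zero_of_notMem_tsupport fun hmem => ?_
  have h1 := tsupport_vecWordDeriv_subset (normalBumpC (B := B)) w hmem
  have h2 : tsupport (normalBumpC (B := B)) ⊆ tsupport (normalBump (B := B)) :=
    closure_mono fun x hx => by simpa [Function.mem_support, normalBumpC] using hx
  have h3 := h2 h1
  rw [ContDiffBump.tsupport_eq, mem_closedBall, dist_zero_right] at h3
  exact (not_lt.2 h3) (by simpa [normalBump] using hb)

/-- **The scaled cutoff** `χ_ε(b, z) = χ(ε⁻¹ b)` on `B × Z`. [folklore] -/
def normalCutoff (ε : ℝ) (x : B × Z) : ℂ := normalBumpC (ε⁻¹ • x.1)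

/-- `χ_ε = 1` where `‖b‖ ≤ ε` (`0 < ε`). [folklore] -/
theorem normalCutoff_eq_one {ε : ℝ} (hε : 0 < ε) {x : B × Z} (hx : ‖x.1‖ ≤ ε) : normalCutoff ε x = 1 := by
  refine normalBumpC_eq_one ?_
  rw [norm_smul, norm_inv, Real.norm_eq_abs, abs_of_pos hε]
  rw [inv_mul_le_iff₀ hε, mul_one]
  exact hx

variable [NormedAddCommGroup Z] [NormedSpace ℝ Z]

omit [FiniteDimensional ℝ B] in
/-- The scaling map `x ↦ ε⁻¹ x.1` as a continuous linear map. [folklore] -/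
def normalScaleFst (ε : ℝ) : B × Z →L[ℝ] B := ε⁻¹ • ContinuousLinearMap.fst ℝ B Z

omit [FiniteDimensional ℝ B] in
/-- `normalScaleFst ε x = ε⁻¹ • x.1`. [folklore] -/
@[simp] theorem normalScaleFst_apply (ε : ℝ) (x : B × Z) : normalScaleFst (Z := Z) ε x = ε⁻¹ • x.1 := rfl

/-- `χ_ε = χ ∘ normalScaleFst ε`. [folklore] -/
theorem normalCutoff_eq_comp (ε : ℝ) : normalCutoff (B := B) (Z := Z) ε = fun x => normalBumpC (normalScaleFst ε x) := rfl

/-- `χ_ε` is smooth. [folklore] -/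
theorem contDiff_normalCutoff (ε : ℝ) : ContDiff ℝ ∞ (normalCutoff (B := B) (Z := Z) ε) := by
  rw [normalCutoff_eq_comp]
  have h2 : ContDiff ℝ ∞ (normalScaleFst (B := B) (Z := Z) ε : B × Z → B) := (normalScaleFst (B := B) (Z := Z) ε).contDiff
  exact isTestFn_normalBumpC.contDiff.comp h2

/-- **The word derivatives of the scaled cutoff**: `∂_u χ_ε (x) = ε^{-|u|} (∂_{u₁} χ)(ε⁻¹ x₁)` with
`u₁` the list of first components. [folklore] -/
theorem vecWordDeriv_normalCutoff (ε : ℝ) (u : List (B × Z)) (x : B × Z) :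
    vecWordDeriv u (normalCutoff ε) x =
      ((ε⁻¹ : ℝ) : ℂ) ^ u.length * vecWordDeriv (u.map Prod.fst) normalBumpC (ε⁻¹ • x.1) := by
  rw [normalCutoff_eq_comp, vecWordDeriv_comp_clm (normalScaleFst ε) isTestFn_normalBumpC.contDiff u]
  have hmap : u.map (normalScaleFst (Z := Z) ε) = (u.map Prod.fst).map fun b => ε⁻¹ • b := by
    rw [List.map_map]; rfl
  simp only [hmap, vecWordDeriv_map_smul, Pi.smul_apply, smul_eq_mul, List.length_map, normalScaleFst_apply]

/-- **Bounds for the scaled cutoff**: for each word `u` there is `C` with `|∂_u χ_ε (x)| ≤ C ε^{-|u|}` for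
`0 < ε`, and `∂_u χ_ε (x) = 0` unless `‖x₁‖ ≤ 2ε`. [folklore] -/
theorem exists_bound_vecWordDeriv_normalCutoff (u : List (B × Z)) :
    ∃ C : ℝ, 0 ≤ C ∧ ∀ ε : ℝ, 0 < ε → ∀ x : B × Z,
      ‖vecWordDeriv u (normalCutoff (Z := Z) ε) x‖ ≤ C * (ε⁻¹) ^ u.length ∧
        (2 * ε < ‖x.1‖ → vecWordDeriv u (normalCutoff (Z := Z) ε) x = 0) := by
  have hT : IsTestFn (vecWordDeriv (u.map Prod.fst) (normalBumpC (B := B))) := isTestFn_normalBumpC.vecWordDeriv _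
  obtain ⟨C, hC⟩ := hT.hasCompactSupport.exists_bound_of_continuous hT.contDiff.continuous
  refine ⟨max C 0, le_max_right _ _, fun ε hε x => ⟨?_, fun hfar => ?_⟩⟩
  · rw [vecWordDeriv_normalCutoff, norm_mul, norm_pow, Complex.norm_real, Real.norm_eq_abs, abs_of_pos (inv_pos.2 hε),
      mul_comm]
    exact mul_le_mul_of_nonneg_right ((hC _).trans (le_max_left _ _)) (pow_nonneg (inv_pos.2 hε).le _)
  · rw [vecWordDeriv_normalCutoff, vecWordDeriv_normalBumpC_eq_zero _ ?_, mul_zero]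
    rw [norm_smul, norm_inv, Real.norm_eq_abs, abs_of_pos hε, lt_inv_mul_iff₀ hε]
    linarith

omit [NormedSpace ℝ Z] in
/-- `(1 - χ_ε) h` vanishes near the subspace `{0} × Z`: a point of its support has `x₁ ≠ 0`. [folklore] -/
theorem fst_ne_zero_of_mem_tsupport_one_sub_normalCutoff_mul {ε : ℝ} (hε : 0 < ε) (h : B × Z → ℂ) {x : B × Z}
    (hx : x ∈ tsupport (fun y => (1 - normalCutoff ε y) * h y)) : x.1 ≠ 0 := by
  intro hx1
  refine (notMem_tsupport_iff_eventuallyEq.2 ?_) hx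
  have hopen : IsOpen {y : B × Z | ‖y.1‖ < ε} := isOpen_lt (continuous_norm.comp continuous_fst) continuous_const
  have hmem : x ∈ {y : B × Z | ‖y.1‖ < ε} := by simp [hx1, hε]
  filter_upwards [hopen.mem_nhds hmem] with y hy
  rw [Pi.zero_apply, normalCutoff_eq_one hε (le_of_lt hy), sub_self, zero_mul]

end Cutoff

/-! ### 3. Hörmander's Theorem 2.3.3 -/

section Flat

variable {B Z : Type*} [NormedAddCommGroup B] [NormedSpace ℝ B] [NormedAddCommGroup Z] [NormedSpace ℝ Z]

/-- **`D` depends only on the normal jets of order `< j` on the test functions supported in `V`.**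
[cite: HormanderALPDO1, Thm. 2.3.3] -/
def NormalOrderBelow (D : (B × Z → ℂ) → ℂ) (V : Set (B × Z)) (j : ℕ) : Prop :=
  ∀ h : B × Z → ℂ, IsTestFn h → tsupport h ⊆ V → NormalJetsVanishBelow j h → D h = 0

/-- Shrinking the set preserves `NormalOrderBelow`. [folklore] -/
theorem NormalOrderBelow.mono {D : (B × Z → ℂ) → ℂ} {V V' : Set (B × Z)} {j : ℕ} (h : NormalOrderBelow D V j)
    (hV : V' ⊆ V) : NormalOrderBelow D V' j := fun g hg hgV hflat => h g hg (hgV.trans hV) hflat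

/-- Order `0` means: `D` vanishes on the test functions supported in `V`. [folklore] -/
theorem NormalOrderBelow.apply_eq_zero {D : (B × Z → ℂ) → ℂ} {V : Set (B × Z)} (h : NormalOrderBelow D V 0)
    {g : B × Z → ℂ} (hg : IsTestFn g) (hgV : tsupport g ⊆ V) : D g = 0 :=
  h g hg hgV (normalJetsVanishBelow_zero g)

/-- If `‖c‖ ≤ K ε` for all `0 < ε ≤ 1` then `c = 0`. [folklore] -/
theorem eq_zero_of_norm_le_mul {c : ℂ} {K : ℝ} (h : ∀ ε : ℝ, 0 < ε → ε ≤ 1 → ‖c‖ ≤ K * ε) : c = 0 := by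
  by_contra hc
  have hcpos : 0 < ‖c‖ := norm_pos_iff.2 hc
  have hK : 0 < K := by
    have := h 1 one_pos le_rfl
    nlinarith
  set ε : ℝ := min 1 (‖c‖ / (2 * K)) with hεdef
  have hεpos : 0 < ε := lt_min one_pos (div_pos hcpos (by linarith))
  have hε1 : ε ≤ 1 := min_le_left _ _
  have hle := h ε hεpos hε1
  have hε2 : K * ε ≤ ‖c‖ / 2 := by
    calc K * ε ≤ K * (‖c‖ / (2 * K)) := mul_le_mul_of_nonneg_left (min_le_right _ _) hK.le
      _ = ‖c‖ / 2 := by field_simp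
  linarith

variable [FiniteDimensional ℝ B]

/-- **One Leibniz term is `O(ε)`**: for `|u| + |v| ≤ k` and a test function `h` flat below order `k + 1`,
`|∂_u χ_ε (x) · ∂_v h (x)| ≤ A ε` for `0 < ε ≤ 1`. [cite: HormanderALPDO1, Thm. 2.3.3 (proof)] -/
theorem exists_bound_leibnizTerm {h : B × Z → ℂ} (hh : IsTestFn h) {k : ℕ} (hflat : NormalJetsVanishBelow (k + 1) h)
    {u v : List (B × Z)} (huv : u.length + v.length ≤ k) :
    ∃ A : ℝ, 0 ≤ A ∧ ∀ ε : ℝ, 0 < ε → ε ≤ 1 → ∀ x : B × Z,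
      ‖vecWordDeriv u (normalCutoff ε) x * vecWordDeriv v h x‖ ≤ A * ε := by
  obtain ⟨C, hC0, hC⟩ := exists_bound_vecWordDeriv_normalCutoff (B := B) (Z := Z) u
  -- Taylor flatness of `∂_v h` of order `m + 1 = k + 1 - |v|`
  set m : ℕ := k - v.length with hm
  have hmv : k + 1 - v.length = m + 1 := by omega
  have hflat' : NormalJetsVanishBelow (m + 1) (vecWordDeriv v h) := by
    rw [← hmv]; exact hflat.vecWordDeriv hh.contDiff v
  obtain ⟨A, hA0, hA⟩ := exists_norm_le_pow_of_normalJetsVanishBelow (hh.vecWordDeriv v) hflat'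
  refine ⟨C * A * 2 ^ (m + 1), by positivity, fun ε hε hε1 x => ?_⟩
  obtain ⟨hb1, hb2⟩ := hC ε hε x
  by_cases hfar : 2 * ε < ‖x.1‖
  · rw [hb2 hfar, zero_mul, norm_zero]; positivity
  · rw [not_lt] at hfar
    rw [norm_mul]
    have h1 : ‖vecWordDeriv v h x‖ ≤ A * (2 * ε) ^ (m + 1) := by
      have := hA x.1 x.2
      rw [Prod.mk.eta] at this
      exact this.trans (mul_le_mul_of_nonneg_left (pow_le_pow_left₀ (norm_nonneg _) hfar _) hA0)
    have h2 : (ε⁻¹) ^ u.length * (2 * ε) ^ (m + 1) ≤ 2 ^ (m + 1) * ε := by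
      -- `m + 1 = |u| + (d + 1)`, so `ε^{-|u|} (2ε)^{m+1} = 2^{m+1} ε^{d+1} ≤ 2^{m+1} ε`
      obtain ⟨d, hd⟩ : ∃ d, m + 1 = u.length + (d + 1) := ⟨m - u.length, by omega⟩
      rw [hd]
      have hεu : (ε⁻¹) ^ u.length * ε ^ u.length = 1 := by rw [← mul_pow, inv_mul_cancel₀ hε.ne', one_pow]
      have hεd : ε ^ d ≤ 1 := pow_le_one₀ hε.le hε1
      calc (ε⁻¹) ^ u.length * (2 * ε) ^ (u.length + (d + 1))
          = 2 ^ (u.length + (d + 1)) * ((ε⁻¹) ^ u.length * ε ^ u.length) * (ε ^ d * ε) := by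
            rw [mul_pow, pow_add ε, pow_succ]; ring
        _ = 2 ^ (u.length + (d + 1)) * (ε ^ d * ε) := by rw [hεu, mul_one]
        _ ≤ 2 ^ (u.length + (d + 1)) * (1 * ε) :=
            mul_le_mul_of_nonneg_left (mul_le_mul_of_nonneg_right hεd hε.le) (by positivity)
        _ = 2 ^ (u.length + (d + 1)) * ε := by rw [one_mul]
    calc ‖vecWordDeriv u (normalCutoff ε) x‖ * ‖vecWordDeriv v h x‖
        ≤ (C * (ε⁻¹) ^ u.length) * (A * (2 * ε) ^ (m + 1)) :=
          mul_le_mul hb1 h1 (norm_nonneg _) (by positivity)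
      _ = C * A * ((ε⁻¹) ^ u.length * (2 * ε) ^ (m + 1)) := by ring
      _ ≤ C * A * (2 ^ (m + 1) * ε) := mul_le_mul_of_nonneg_left h2 (by positivity)
      _ = C * A * 2 ^ (m + 1) * ε := by ring

/-- **All seminorms of `χ_ε h` of order `≤ k` are `O(ε)`** for `h` flat below order `k + 1` (Leibniz rule
over `wordPairs`). [cite: HormanderALPDO1, Thm. 2.3.3 (proof)] -/
theorem exists_bound_vecWordDeriv_normalCutoff_mul {h : B × Z → ℂ} (hh : IsTestFn h) {k : ℕ}
    (hflat : NormalJetsVanishBelow (k + 1) h) {w : List (B × Z)} (hw : w.length ≤ k) :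
    ∃ A : ℝ, 0 ≤ A ∧ ∀ ε : ℝ, 0 < ε → ε ≤ 1 → ∀ x : B × Z,
      ‖vecWordDeriv w (normalCutoff ε * h) x‖ ≤ A * ε := by
  -- induction over the list of splittings
  have key : ∀ L : List (List (B × Z) × List (B × Z)), (∀ p ∈ L, p.1.length + p.2.length ≤ k) →
      ∃ A : ℝ, 0 ≤ A ∧ ∀ ε : ℝ, 0 < ε → ε ≤ 1 → ∀ x : B × Z,
        ‖(L.map fun p => vecWordDeriv p.1 (normalCutoff (Z := Z) ε) * vecWordDeriv p.2 h).sum x‖ ≤ A * ε := by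
    intro L
    induction L with
    | nil => intro; exact ⟨0, le_rfl, fun ε _ _ x => by simp⟩
    | cons p L ih =>
      intro hL
      obtain ⟨A₁, hA₁, h₁⟩ := exists_bound_leibnizTerm hh hflat (hL p List.mem_cons_self)
      obtain ⟨A₂, hA₂, h₂⟩ := ih fun q hq => hL q (List.mem_cons_of_mem _ hq)
      refine ⟨A₁ + A₂, add_nonneg hA₁ hA₂, fun ε hε hε1 x => ?_⟩
      rw [List.map_cons, List.sum_cons, Pi.add_apply, add_mul]
      exact (norm_add_le _ _).trans (add_le_add (by simpa using h₁ ε hε hε1 x) (h₂ ε hε hε1 x))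
  obtain ⟨A, hA0, hA⟩ := key (wordPairs w) fun p hp => (length_add_length_of_mem_wordPairs hp).le.trans hw
  refine ⟨A, hA0, fun ε hε hε1 x => ?_⟩
  rw [vecWordDeriv_mul (contDiff_normalCutoff ε) hh.contDiff]
  exact hA ε hε hε1 x

/-- **Hörmander's Theorem 2.3.3** (flat form): let `D` be additive on the test functions supported in `W`,
satisfy on `κ ⊆ W` a distribution estimate by word derivatives of length `≤ k`, and vanish on the test
functions supported in `κ` off `{0} × Z`. Then `D h = 0` for every test `h` supported in `κ` whose normal
jets of order `≤ k` vanish on `{0} × Z`. [cite: HormanderALPDO1, Thm. 2.3.3] -/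
theorem apply_eq_zero_of_normalJetsVanishBelow {D : (B × Z → ℂ) → ℂ} {W : Set (B × Z)}
    (hadd : ∀ f g : B × Z → ℂ, IsTestFn f → IsTestFn g → tsupport f ⊆ W → tsupport g ⊆ W → D (f + g) = D f + D g)
    {κ : Set (B × Z)} (hκW : κ ⊆ W) {C : ℝ} {𝒮 : Finset (List (B × Z))}
    (hb : ∀ f : B × Z → ℂ, IsTestFn f → tsupport f ⊆ κ →
      ∀ M : ℝ, (∀ w ∈ 𝒮, ∀ x, ‖vecWordDeriv w f x‖ ≤ M) → ‖D f‖ ≤ C * M)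
    (hvan : ∀ g : B × Z → ℂ, IsTestFn g → tsupport g ⊆ κ → (∀ x ∈ tsupport g, x.1 ≠ 0) → D g = 0)
    {k : ℕ} (hk : ∀ w ∈ 𝒮, w.length ≤ k)
    {h : B × Z → ℂ} (hh : IsTestFn h) (hhκ : tsupport h ⊆ κ) (hflat : NormalJetsVanishBelow (k + 1) h) :
    D h = 0 := by
  classical
  -- one constant for all the seminorms in `𝒮`
  have hword : ∀ w ∈ 𝒮, ∃ A : ℝ, 0 ≤ A ∧ ∀ ε : ℝ, 0 < ε → ε ≤ 1 → ∀ x : B × Z,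
      ‖vecWordDeriv w (normalCutoff ε * h) x‖ ≤ A * ε := fun w hw =>
    exists_bound_vecWordDeriv_normalCutoff_mul hh hflat (hk w hw)
  choose! Aw hAw0 hAw using hword
  set A : ℝ := ∑ w ∈ 𝒮, Aw w with hAdef
  have hAwle : ∀ w ∈ 𝒮, Aw w ≤ A := fun w hw =>
    Finset.single_le_sum (fun w' hw' => hAw0 w' hw') hw
  refine eq_zero_of_norm_le_mul (K := C * A) fun ε hε hε1 => ?_
  -- `h = χ_ε h + (1 - χ_ε) h`, the second piece is invisible
  have hχT : IsTestFn (normalCutoff (Z := Z) ε * h) := hh.mul_left (contDiff_normalCutoff (B := B) (Z := Z) ε)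
  have h1χT : IsTestFn (fun y => (1 - normalCutoff (Z := Z) ε y) * h y) :=
    hh.mul_left (contDiff_const.sub (contDiff_normalCutoff (B := B) (Z := Z) ε))
  have hχsupp : tsupport (normalCutoff (Z := Z) ε * h) ⊆ κ :=
    (tsupport_mul_subset_right (f := normalCutoff ε) (g := h)).trans hhκ
  have h1χsupp : tsupport (fun y => (1 - normalCutoff (Z := Z) ε y) * h y) ⊆ κ :=
    (tsupport_mul_subset_right (f := fun y => 1 - normalCutoff ε y) (g := h)).trans hhκ
  have hsplit : h = normalCutoff ε * h + fun y => (1 - normalCutoff ε y) * h y := by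
    funext y; simp [sub_mul]
  have hD : D h = D (normalCutoff ε * h) := by
    conv_lhs => rw [hsplit]
    rw [hadd _ _ hχT h1χT (hχsupp.trans hκW) (h1χsupp.trans hκW),
      hvan _ h1χT h1χsupp (fun x hx => fst_ne_zero_of_mem_tsupport_one_sub_normalCutoff_mul hε h hx), add_zero]
  rw [hD]
  calc ‖D (normalCutoff ε * h)‖ ≤ C * (A * ε) :=
        hb _ hχT hχsupp (A * ε) fun w hw x => (hAw w hw ε hε hε1 x).trans
          (mul_le_mul_of_nonneg_right (hAwle w hw) hε.le)
    _ = C * A * ε := by ring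

/-- **Theorem 2.3.3, local form**: an additive functional of finite order on `U ⊆ B × Z` which vanishes near
the points off `{0} × Z` of a neighbourhood of `x₀ = (0, z₀) ∈ U` sees, near `x₀`, only finitely many
normal jets: `NormalOrderBelow D V (k+1)` for a neighbourhood `V` of `x₀` and some `k`.
[cite: HormanderALPDO1, Thm. 2.3.3] -/
theorem exists_nhds_normalOrderBelow {D : (B × Z → ℂ) → ℂ} {U : Set (B × Z)} [FiniteDimensional ℝ Z]
    (hadd : ∀ f g : B × Z → ℂ, IsTestFn f → IsTestFn g → tsupport f ⊆ U → tsupport g ⊆ U → D (f + g) = D f + D g)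
    (hD : IsFiniteOrderOn U D) {x₀ : B × Z} (hx₀ : x₀ ∈ U) (hU : IsOpen U)
    (hvan : ∃ V₀ ∈ 𝓝 x₀, ∀ g : B × Z → ℂ, IsTestFn g → tsupport g ⊆ V₀ → (∀ x ∈ tsupport g, x.1 ≠ 0) → D g = 0) :
    ∃ V ∈ 𝓝 x₀, ∃ k : ℕ, NormalOrderBelow D V (k + 1) := by
  obtain ⟨V₀, hV₀, hvan⟩ := hvan
  obtain ⟨r, hr, hrsub⟩ := Metric.mem_nhds_iff.1 (inter_mem (hU.mem_nhds hx₀) hV₀)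
  set κ : Set (B × Z) := closedBall x₀ (r / 2) with hκ
  have hκsub : κ ⊆ U ∩ V₀ := (closedBall_subset_ball (by linarith)).trans hrsub
  have hκc : IsCompact κ := isCompact_closedBall _ _
  obtain ⟨C, 𝒮, _, hb⟩ := hD κ hκc (hκsub.trans inter_subset_left)
  refine ⟨κ, closedBall_mem_nhds _ (by linarith), 𝒮.sup List.length, ?_⟩
  intro h hh hhκ hflat
  exact apply_eq_zero_of_normalJetsVanishBelow hadd (hκsub.trans inter_subset_left) hb
    (fun g hg hgκ hoff => hvan g hg (hgκ.trans (hκsub.trans inter_subset_right)) hoff)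
    (fun w hw => Finset.le_sup (f := List.length) hw) hh hhκ hflat

end Flat

end Literature.Analysis.Distribution
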